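import Summits.HodgeConjecture.HodgeConjecture.Theorems.R90S6HyperbolicHeckeFLClosed        -- ★ (B2d) CLOSED p864596 (this seat): the framed clause `…_of_levi_of_frames`
import Literature.NumberTheory.Automorphic.CMLocalNonsplitBorelTransport                   -- ★ `coe_coe_localNonsplitEquiv_apply`, `localNonsplitEquiv` (one place above a non-split `v`)
import Literature.NumberTheory.Automorphic.CMBorelUnipotentIndexModulus                     -- ★ `isClosed_cmBorelTriple_N`
import HarnessLib

/-!
# R90 · S6 «Ch. 14.1–14.5 stable TF» — card (B2d)-AT-PLACE: THE HYPERBOLIC CLAUSE OF THE HECKE-ALGEBRA FUNDAMENTAL LEMMA AT `Δ‴_v`, AT THE ONE-PLACE MODEL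
# (`Theorems/R90S6HyperbolicHeckeFLAtPlace.lean`)

Cell `hodgecm-mathlib`, crux H413 (`stmt-HodgeConjecture-24833`), route of record `HCCMUnconditional`; programme R90-TF (brief `director/R90-BRIEF.v2.md` 1f40d54518340a35),
section S6 (base `R90-C14`, dealer R90-C14-plan (g2)), seat R90-C14-p09 (g2); card dealt R2 2026-09-05T02:13:14Z (census «=» 02:15:20Z); DAG row E1.3.6.2.  Lane `--kind proof
--supports stmt-HodgeConjecture-24833 --as helper`; THEOREMS ONLY (no definition ∕ instance ∕ notation ∕ named fact ∕ kit ∕ `sorry`); imports = ★ (B2d) CLOSED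
`R90S6HyperbolicHeckeFLClosed` (p864596) + ★ `CMLocalNonsplitBorelTransport` + ★ `CMBorelUnipotentIndexModulus` + HarnessLib (Theorems → Theorems ∕ Literature; never `Lines/`).

## THE PRINT
[Rogawski1990, §4.9 Prop. 4.9.1 (b), (4.9.2), Lemma 4.9.2 pp. 54–56]: `ξ̂_H(f)` is a transfer of `f ∈ ℋ_G` — on the diagonal torus `Φ(γ, f) = |D(γ)|⁻¹ f^{(B)}(γ)` on both groups
([CartierCorvallis1979, §IV (4.2)]); the local groups at ONE place `w ∣ v` of a non-split `v`: `U(J)(L⁺_v) = U(J)(L_w)` entrywise ([PlatonovRapinchuk1994, §5.1]).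

## WHAT IS PROVED (namespace `Summit.HodgeConjecture.HodgeConjecture.R90.S6`)
* §1 LETTERS of the one-place model `g ↦ g_w` (`heA : ↑(eA g) = ↑(localNonsplitEquiv … g)`, the binder-pair shape of ★ `F0P3cStCharTSStLevelsTransport`):
  `mem_upperUnitriangular_iff_of_coe_eq_map`, **`apply_mem_unitaryInt_iff_of_coe_eq`** (K-LAW `eA g ∈ K₀ ↔ g ∈ U(J)(𝒪_v)` — also the socket K-law of `eG` for the
  assembler, with `hlev`), **`apply_mem_unipotentU_iff_of_coe_eq`** (N-LAW), `coe_apply_eq_diagonal_of_coe_eq` (torus entries), and the generic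
  `exists_continuousMulEquiv_subgroup_of_forall_mem_iff` (restriction `H ≃ₜ* H′` of `e : G ≃ₜ* G′` to matched subgroups, ★ `subgroupCongrHomeomorph`).
* §2 **`stableOrbitalIntegralRel_coeff_toVector_eq_finsum_finExplicitDelta_of_levi_atPlace`** — ★ (B2d) CLOSED `…_of_levi_of_frames` INSTANTIATED at the one-place models
  `eA₃`, `eA₂` and a LEVEL-MATCHING stub frame `e = cmDatumLocalCongr L v T₀ ha₀ hT₀` (`hlev` = the body of ★ `eventually_exists_cmDatumLocalCongr_levelMatching_all`, cofinite
  in `v` — the socket's `∃ S_bad`): `Φ^st(γ_H, T₂[K₀] ∘ eA₂ ∘ fst) = ∑ᶠ c, Δ‴_v(γ_H, out c) · Φ(c, T₃[K₀] ∘ (e⁻¹ ≫ eA₃))` for `γ_H` on the Levi stratum, `G`-regular, `ord_w d′₀ = m`.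
  DISCHARGED: `hN hEK hN₂ hEK₂` and `EN EN₂` (§1), `hEt hEHt` (§1 + ★ `endoEmbLocal_eq_glDiagonal_of_fst_eq`), `νG(e U(Φ₃)(𝒪_v)) = νG(K′) = 1` (`hlev`), and ALL auxiliary
  Iwasawa data (Borel structures `borel _`; Mathlib `Measure.haar` on the compact levels and the closed radicals, finite on `K` resp. `N ∩ K`; ★ `locallyCompactSpace_local`,
  `secondCountableTopology_local`, `isCompact_isOpen_cmLocalIntegralLevel`, `isClosed_cmBorelTriple_N`, `isClosed_unipotentU`).  SURVIVING BINDERS: the socket HEAD block,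
  `νG hmG hνG`, `νH hmH hνH`, `T₀ ha₀ hT₀ hlev`, the level names `K₃ K₂` (pinned by `hK₃v`, `hK₂eq`), `(eA₃, heA₃)`, `(eA₂, heA₂)`, `hdw φ φH hgraph`, `γH d′ hd′ hreg ha hb h12 hm`.
LEFT TO THE E1.3.6 ASSEMBLER (Lines level): `heckeToFun` ∕ `SatakeGraph` `rfl`-dressing, arbitrary socket frames (★ (A.3) ∕ (A.6)), off-stratum `γ_H` (conjugation in `H_v`).
ENGINEERING NOTES: (a) auxiliary data enter by `have h : ∃ … := ⟨…⟩; obtain … := h` (a direct `obtain … := ⟨term⟩` ∕ `set` generalizes over the large goal and exhausts the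
budget); (b) `e⁻¹ ⁻¹' K₃ = U(H′)(𝒪_v)` is proved by explicit `mem_preimage` ∕ `mem_coe` steps — a bare `(hK₃v _).trans (hlev g)` elaborates but makes the KERNEL compare the
carriers `U(Φ₃)_v`, `U(H′)_v` (kernel deterministic timeout); (c) `maxHeartbeats 800000` ∕ `synthInstance.maxHeartbeats 200000` for the final application only.
HONEST LABEL: helper theorem, count-neutral until E1.3.6.2 closes; proves no printed global statement by itself, discharges no citation.  HC_CM is proved only modulo the 7
printed citations (2 remaining named inputs: hLiu418 = stmt-HodgeConjecture-24832, h413 = stmt-HodgeConjecture-24833) until rung 0 closes; REL ≠ ★ ≠ BUILT.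

Dedup: `rg` of the six new names over `lean/` — no hit (2026-09-05); every cited organ is ★ and used BY NAME.

## References
* [Rogawski1990] J. D. Rogawski, *Automorphic Representations of Unitary Groups in Three Variables*, Ann. of Math. Stud. 123 (1990): §4.9 pp. 54–56; §4.5 p. 45; §1.10 p. 9.
* [CartierCorvallis1979] P. Cartier, *Representations of 𝔭-adic groups: a survey*, PSPM 33.1 (1979): §IV (4.2) p. 146.
* [PlatonovRapinchuk1994] V. Platonov, A. Rapinchuk, *Algebraic Groups and Number Theory*, Academic Press (1994): §5.1; §2.3.
-/

set_option autoImplicit false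
-- the mandated namespace repeats the single-problem summit's segment (`HodgeConjecture.HodgeConjecture`)
set_option linter.dupNamespace false

noncomputable section

open MeasureTheory Measure Set NumberField IsDedekindDomain Matrix
open Literature.NumberTheory.Automorphic Literature.NumberTheory.Automorphic.UnitaryGroup
open Literature.NumberTheory.Automorphic.HermitianLattice Literature.NumberTheory.Automorphic.HermitianLattice.UnramifiedLocalConjDatum
open Literature.NumberTheory.GaloisRepresentations
open Literature.NumberTheory.Rogawski1990
open Literature.MeasureTheory.Group
open scoped NNReal ENNReal Matrix MatrixGroups Valued WithZero Topology

namespace Summit.HodgeConjecture.HodgeConjecture.R90.S6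

/-! ## §1 Letters of the one-place model `g ↦ g_w` at a non-split place: radical, level and torus entries are read entrywise at `w` -/

section OnePlace

variable (L : Type) [Field L] [NumberField L] [IsCMField L] {v : HeightOneSpectrum (𝓞 ↥(maximalRealSubfield L))}
  (w : PlacesOver L v) (hw : IsCMField.complexConj L • w.1 = w.1)

include hw in
/-- **Upper-unitriangularity is read at the one place `w`**: for `g ∈ GL_N(∏_{w′∣v} L_{w′})` at a non-split `v` and `g′ ∈ GL_N(L_w)` with matrix the `w`-component of
that of `g` (e.g. `g′ = localNonsplitEquiv g`, ★ `coe_coe_localNonsplitEquiv_apply`), `g′` is upper unitriangular iff `g` is (an entry of `∏_{w′∣v} L_{w′}` is determined by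
its `w`-component, ★ `LocalRing.eq_iff_apply_eq`). [cite: PlatonovRapinchuk1994, §5.1] [cite: Rogawski1990, §1.10 p. 9] -/
theorem mem_upperUnitriangular_iff_of_coe_eq_map {N : ℕ} {g' : GL (Fin N) (w.1.adicCompletion L)} {g : GL (Fin N) (UnitaryGroup.LocalRing L v)}
    (h : (g' : Matrix (Fin N) (Fin N) (w.1.adicCompletion L)) =
      (g : Matrix (Fin N) (Fin N) (UnitaryGroup.LocalRing L v)).map (Pi.evalRingHom (fun w' : PlacesOver L v => w'.1.adicCompletion L) w)) :
    g' ∈ upperUnitriangular (Fin N) (w.1.adicCompletion L) ↔ g ∈ upperUnitriangular (Fin N) (UnitaryGroup.LocalRing L v) := by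
  have hc := IsCMField.complexConj_ne_one L
  haveI : Algebra.IsQuadraticExtension ↥(maximalRealSubfield L) L := IsCMField.isQuadraticExtension L
  have he : ∀ i j, (g' : Matrix (Fin N) (Fin N) (w.1.adicCompletion L)) i j = (g : Matrix (Fin N) (Fin N) (UnitaryGroup.LocalRing L v)) i j w := by
    intro i j; rw [h, Matrix.map_apply, Pi.evalRingHom_apply]
  rw [mem_upperUnitriangular_iff, mem_upperUnitriangular_iff]
  refine and_congr ⟨fun hT i j hij => ?_, fun hT i j hij => ?_⟩ (forall_congr' fun i => ?_)
  · exact (UnitaryGroup.LocalRing.eq_iff_apply_eq (IsCMField.complexConj L) hc w hw _ 0).2 (by rw [← he]; exact hT hij)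
  · rw [he, hT hij]; rfl
  · rw [he]
    exact (UnitaryGroup.LocalRing.eq_iff_apply_eq (IsCMField.complexConj L) hc w hw _ 1).symm

include hw in
/-- **The hyperspecial level is read at the one place `w`**: for a transport `eA` onto the socket's carrier `U(σ_w, J₀)(L_w)` whose matrices are those of the one-place model
(`heA`), `eA g ∈ K₀ = unitaryInt ↔ g ∈ U(J)(𝒪_v)` (★ `mem_unitaryInt_iff`, ★ `mem_glInt_iff_forall_v_le_one`, ★ `mem_localIntegralLevel_iff_of_smul_eq`).
[cite: PlatonovRapinchuk1994, §5.1] [cite: Rogawski1990, §4.5 p. 45] -/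
theorem apply_mem_unitaryInt_iff_of_coe_eq {N : ℕ} (J : Matrix (Fin N) (Fin N) L)
    (eA : (cmDatum L N J).Local v ≃ₜ* ↥(unitaryGroupOfForm (galAdicCompletionMap (L := L) (IsCMField.complexConj L) hw) ((StdForm.antidiagonal N).over (w.1.adicCompletion L))))
    (heA : ∀ g : (cmDatum L N J).Local v,
      ((eA g : ↥(unitaryGroupOfForm (galAdicCompletionMap (L := L) (IsCMField.complexConj L) hw) ((StdForm.antidiagonal N).over (w.1.adicCompletion L)))) :
          GL (Fin N) (w.1.adicCompletion L)) =
        ((localNonsplitEquiv (IsCMField.complexConj L) J (IsCMField.complexConj_ne_one L) w hw g :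
          ↥(unitaryGroupOfForm (galAdicCompletionMap (L := L) (IsCMField.complexConj L) hw) (placeForm J w.1))) : GL (Fin N) (w.1.adicCompletion L)))
    (g : (cmDatum L N J).Local v) :
    eA g ∈ unitaryInt (galAdicCompletionMap (L := L) (IsCMField.complexConj L) hw) ((StdForm.antidiagonal N).over (w.1.adicCompletion L)) ↔
      g ∈ cmLocalIntegralLevel L N J v := by
  haveI : Algebra.IsQuadraticExtension ↥(maximalRealSubfield L) L := IsCMField.isQuadraticExtension L
  rw [mem_unitaryInt_iff, heA g, ← Literature.NumberTheory.Automorphic.mem_glInt_iff_forall_v_le_one]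
  exact (mem_localIntegralLevel_iff_of_smul_eq (IsCMField.complexConj L) N J (IsCMField.complexConj_ne_one L) w hw g).symm

include hw in
/-- **The unipotent radical is read at the one place `w`**: with `eA`, `heA` as above, `eA g ∈ N′ = unipotentU ↔ g ∈ N = (cmBorelTriple L N v).N` (both are «the matrix is upper
unitriangular», `mem_upperUnitriangular_iff_of_coe_eq_map` + ★ `coe_coe_localNonsplitEquiv_apply`). [cite: PlatonovRapinchuk1994, §5.1] [cite: Rogawski1990, §1.10 p. 9] -/
theorem apply_mem_unipotentU_iff_of_coe_eq {N : ℕ}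
    (eA : (cmDatum L N (Matrix.of fun i j : Fin N => if i.val + j.val + 1 = N then (1 : L) else 0)).Local v ≃ₜ*
      ↥(unitaryGroupOfForm (galAdicCompletionMap (L := L) (IsCMField.complexConj L) hw) ((StdForm.antidiagonal N).over (w.1.adicCompletion L))))
    (heA : ∀ g : (cmDatum L N (Matrix.of fun i j : Fin N => if i.val + j.val + 1 = N then (1 : L) else 0)).Local v,
      ((eA g : ↥(unitaryGroupOfForm (galAdicCompletionMap (L := L) (IsCMField.complexConj L) hw) ((StdForm.antidiagonal N).over (w.1.adicCompletion L)))) :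
          GL (Fin N) (w.1.adicCompletion L)) =
        ((localNonsplitEquiv (IsCMField.complexConj L) (Matrix.of fun i j : Fin N => if i.val + j.val + 1 = N then (1 : L) else 0)
            (IsCMField.complexConj_ne_one L) w hw g :
          ↥(unitaryGroupOfForm (galAdicCompletionMap (L := L) (IsCMField.complexConj L) hw)
            (placeForm (Matrix.of fun i j : Fin N => if i.val + j.val + 1 = N then (1 : L) else 0) w.1))) : GL (Fin N) (w.1.adicCompletion L)))
    (g : ↥(unitaryGroupOfForm (conjLocal L (IsCMField.complexConj L) v) (cmLocalForm L N v))) :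
    g ∈ (cmBorelTriple L N v).N ↔
      eA g ∈ unipotentU (galAdicCompletionMap (L := L) (IsCMField.complexConj L) hw) ((StdForm.antidiagonal N).over (w.1.adicCompletion L)) := by
  haveI : Algebra.IsQuadraticExtension ↥(maximalRealSubfield L) L := IsCMField.isQuadraticExtension L
  have h2 := mem_upperUnitriangular_iff_of_coe_eq_map L w hw
    (g' := ((eA g : ↥(unitaryGroupOfForm (galAdicCompletionMap (L := L) (IsCMField.complexConj L) hw) ((StdForm.antidiagonal N).over (w.1.adicCompletion L)))) :
      GL (Fin N) (w.1.adicCompletion L)))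
    (g := (g : GL (Fin N) (UnitaryGroup.LocalRing L v)))
    (by rw [heA g]; exact coe_coe_localNonsplitEquiv_apply (IsCMField.complexConj L) N _ (IsCMField.complexConj_ne_one L) w hw g)
  exact (Iff.trans (mem_unipotentU_iff_coe _) h2).symm

/-- **Torus entries at the one place**: if `g = diag(d)` in `U(J)(L⁺_v)` then the matrix of `eA g` is `diag(d_w)` (`heA`, ★ `coe_coe_localNonsplitEquiv_apply`, `Matrix.diagonal_map`).
[cite: PlatonovRapinchuk1994, §5.1] -/
theorem coe_apply_eq_diagonal_of_coe_eq {N : ℕ} (J : Matrix (Fin N) (Fin N) L)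
    (eA : (cmDatum L N J).Local v ≃ₜ* ↥(unitaryGroupOfForm (galAdicCompletionMap (L := L) (IsCMField.complexConj L) hw) ((StdForm.antidiagonal N).over (w.1.adicCompletion L))))
    (heA : ∀ g : (cmDatum L N J).Local v,
      ((eA g : ↥(unitaryGroupOfForm (galAdicCompletionMap (L := L) (IsCMField.complexConj L) hw) ((StdForm.antidiagonal N).over (w.1.adicCompletion L)))) :
          GL (Fin N) (w.1.adicCompletion L)) =
        ((localNonsplitEquiv (IsCMField.complexConj L) J (IsCMField.complexConj_ne_one L) w hw g :
          ↥(unitaryGroupOfForm (galAdicCompletionMap (L := L) (IsCMField.complexConj L) hw) (placeForm J w.1))) : GL (Fin N) (w.1.adicCompletion L)))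
    {g : (cmDatum L N J).Local v} {d : Fin N → (UnitaryGroup.LocalRing L v)ˣ}
    (hg : (g.val : GL (Fin N) (UnitaryGroup.LocalRing L v)) = glDiagonal N (UnitaryGroup.LocalRing L v) d) :
    (((eA g : ↥(unitaryGroupOfForm (galAdicCompletionMap (L := L) (IsCMField.complexConj L) hw) ((StdForm.antidiagonal N).over (w.1.adicCompletion L)))) :
        GL (Fin N) (w.1.adicCompletion L)) : Matrix (Fin N) (Fin N) (w.1.adicCompletion L)) =
      Matrix.diagonal fun i => (d i : UnitaryGroup.LocalRing L v) w := by
  haveI : Algebra.IsQuadraticExtension ↥(maximalRealSubfield L) L := IsCMField.isQuadraticExtension L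
  rw [heA g, coe_coe_localNonsplitEquiv_apply (IsCMField.complexConj L) N J (IsCMField.complexConj_ne_one L) w hw g]
  change ((g.val : GL (Fin N) (UnitaryGroup.LocalRing L v)) : Matrix (Fin N) (Fin N) (UnitaryGroup.LocalRing L v)).map _ = _
  rw [hg, coe_glDiagonal, Matrix.diagonal_map (map_zero _)]
  rfl

/-- **Restriction of a topological-group isomorphism to matched subgroups**: for `e : G ≃ₜ* G′` and subgroups `H ≤ G`, `H′ ≤ G′` with `e g ∈ H′ ↔ g ∈ H`, there is a
topological-group isomorphism `E : H ≃ₜ* H′` over `e` (`↑(E h) = e h`; the map is ★ `subgroupCongrHomeomorph`, multiplicative because `e` is).  Used for the restrictions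
`EN : N ≃ₜ* N′` of the one-place models to the unipotent radicals. [cite: PlatonovRapinchuk1994, §5.1] -/
theorem exists_continuousMulEquiv_subgroup_of_forall_mem_iff {G G' : Type*} [Group G] [Group G'] [TopologicalSpace G] [TopologicalSpace G']
    (e : G ≃ₜ* G') (H : Subgroup G) (H' : Subgroup G') (hHH' : ∀ g, e g ∈ H' ↔ g ∈ H) :
    ∃ E : H ≃ₜ* H', ∀ h : H, ((E h : H') : G') = e h :=
  ⟨{ toMulEquiv :=
      { toEquiv := (subgroupCongrHomeomorph e.toMulEquiv H H' hHH' e.continuous e.symm.continuous).toEquiv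
        map_mul' := fun a b => Subtype.ext (map_mul e (a : G) b) }
     continuous_toFun := (subgroupCongrHomeomorph e.toMulEquiv H H' hHH' e.continuous e.symm.continuous).continuous
     continuous_invFun := (subgroupCongrHomeomorph e.toMulEquiv H H' hHH' e.continuous e.symm.continuous).symm.continuous },
    fun _ => rfl⟩

end OnePlace

/-! ## §2 The hyperbolic clause AT THE ONE-PLACE MODEL -/

section AtPlace

-- (raised budgets for the final instance-laden application of ★ CLOSED only — see the module docstring, ENGINEERING NOTES (c); no search tactic, no `decide`)
set_option maxHeartbeats 800000 in
set_option synthInstance.maxHeartbeats 200000 in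
/-- **CARD (B2d)-AT-PLACE — THE HYPERBOLIC (LEVI-STRATUM) CLAUSE OF THE HECKE-ALGEBRA FUNDAMENTAL LEMMA AT `Δ‴_v`, AT THE ONE-PLACE MODEL.**  At a finite place `v` of `L⁺`
non-split (`c • w = w`) and unramified in `L`, `H′` hermitian of good reduction at `w`, `μ` unramified at `w` under the μ-guard; with the socket's CANONICAL families `mG`, `mH`
(`νG(K′) = 1`, `νH(K_H) = 1`), Hecke operators `φ`, `φ^H` in Satake-graph position (`hgraph`), a LEVEL-MATCHING stub frame `e = cmDatumLocalCongr L v T₀ ha₀ hT₀` (`hlev`), the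
ONE-PLACE MODELS `(eA₃, heA₃)`, `(eA₂, heA₂)`, and `γ_H = (diag(d′₀, d′₁), u)` on the Levi stratum, `G`-regular, `ord_w d′₀ = m`:
`Φ^st(γ_H, T₂[K₀] ∘ eA₂ ∘ fst) = ∑ᶠ c, Δ‴_v(γ_H, out c) · Φ(c, T₃[K₀] ∘ (e⁻¹ ≫ eA₃))`.  PROOF = ★ (B2d) CLOSED `…_of_levi_of_frames` with the N-laws ∕ K-laws, restrictions `EN`,
torus entry laws and `νG(e U(Φ₃)(𝒪_v)) = 1` from §1 ∕ `hlev`, at auxiliary Iwasawa measures constructed in-proof (module docstring §2).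
[cite: Rogawski1990, §4.9 Prop. 4.9.1 (b), (4.9.2), Lemma 4.9.2 pp. 54–56] [cite: CartierCorvallis1979, §IV (4.2) p. 146] [cite: PlatonovRapinchuk1994, §5.1] -/
theorem stableOrbitalIntegralRel_coeff_toVector_eq_finsum_finExplicitDelta_of_levi_atPlace
    (L : Type) [Field L] [NumberField L] [IsCMField L] (H' : Matrix (Fin 3) (Fin 3) L)
    (hH' : (H'.map (IsCMField.complexConj L))ᵀ = H') (hH'd : IsUnit H'.det)
    {v : HeightOneSpectrum (𝓞 ↥(maximalRealSubfield L))} (w : PlacesOver L v)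
    (hw : IsCMField.complexConj L • w.1 = w.1) (hv : Algebra.IsUnramifiedIn (𝓞 L) v.asIdeal)
    (hH'w : IsUnit (placeForm H' w.1)) (hH'i : hH'w.unit ∈ glInt 3 (w.1.adicCompletion L))
    (μ : HeckeCharacter L) (hμ : μ.IsUnramifiedAt w.1)
    (hμω : ∀ x : ideleGroup ↥(maximalRealSubfield L), μ (AdeleRing.ideleBaseChange ↥(maximalRealSubfield L) L x) = quadraticHeckeCharCM L x)
    [MeasurableSpace ((cmDatum L 3 H').Local v)] [BorelSpace ((cmDatum L 3 H').Local v)]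
    [∀ γ : ((cmDatum L 3 H').Local v), MeasurableSpace (((cmDatum L 3 H').Local v) ⧸ Subgroup.centralizer ({γ} : Set ((cmDatum L 3 H').Local v)))]
    [∀ γ : ((cmDatum L 3 H').Local v), BorelSpace (((cmDatum L 3 H').Local v) ⧸ Subgroup.centralizer ({γ} : Set ((cmDatum L 3 H').Local v)))]
    [MeasurableSpace ((cmDatum L 2 (Matrix.of fun i j : Fin 2 => if i.val + j.val + 1 = 2 then (1 : L) else 0)).Local v ×
      (cmDatum L 1 (Matrix.of fun i j : Fin 1 => if i.val + j.val + 1 = 1 then (1 : L) else 0)).Local v)]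
    [BorelSpace ((cmDatum L 2 (Matrix.of fun i j : Fin 2 => if i.val + j.val + 1 = 2 then (1 : L) else 0)).Local v ×
      (cmDatum L 1 (Matrix.of fun i j : Fin 1 => if i.val + j.val + 1 = 1 then (1 : L) else 0)).Local v)]
    [∀ a : ((cmDatum L 2 (Matrix.of fun i j : Fin 2 => if i.val + j.val + 1 = 2 then (1 : L) else 0)).Local v ×
      (cmDatum L 1 (Matrix.of fun i j : Fin 1 => if i.val + j.val + 1 = 1 then (1 : L) else 0)).Local v),
      MeasurableSpace (((cmDatum L 2 (Matrix.of fun i j : Fin 2 => if i.val + j.val + 1 = 2 then (1 : L) else 0)).Local v ×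
      (cmDatum L 1 (Matrix.of fun i j : Fin 1 => if i.val + j.val + 1 = 1 then (1 : L) else 0)).Local v) ⧸ Subgroup.centralizer ({a} : Set ((cmDatum L 2 (Matrix.of fun i j : Fin 2 => if i.val + j.val + 1 = 2 then (1 : L) else 0)).Local v ×
      (cmDatum L 1 (Matrix.of fun i j : Fin 1 => if i.val + j.val + 1 = 1 then (1 : L) else 0)).Local v)))]
    [∀ a : ((cmDatum L 2 (Matrix.of fun i j : Fin 2 => if i.val + j.val + 1 = 2 then (1 : L) else 0)).Local v ×
      (cmDatum L 1 (Matrix.of fun i j : Fin 1 => if i.val + j.val + 1 = 1 then (1 : L) else 0)).Local v),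
      BorelSpace (((cmDatum L 2 (Matrix.of fun i j : Fin 2 => if i.val + j.val + 1 = 2 then (1 : L) else 0)).Local v ×
      (cmDatum L 1 (Matrix.of fun i j : Fin 1 => if i.val + j.val + 1 = 1 then (1 : L) else 0)).Local v) ⧸ Subgroup.centralizer ({a} : Set ((cmDatum L 2 (Matrix.of fun i j : Fin 2 => if i.val + j.val + 1 = 2 then (1 : L) else 0)).Local v ×
      (cmDatum L 1 (Matrix.of fun i j : Fin 1 => if i.val + j.val + 1 = 1 then (1 : L) else 0)).Local v)))]
    (hl : ∀ (v : HeightOneSpectrum (𝓞 ↥(maximalRealSubfield L))) (a : ((cmDatum L 2 (Matrix.of fun i j : Fin 2 => if i.val + j.val + 1 = 2 then (1 : L) else 0)).Local v ×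
      (cmDatum L 1 (Matrix.of fun i j : Fin 1 => if i.val + j.val + 1 = 1 then (1 : L) else 0)).Local v)) (b : (cmDatum L 3 H').Local v) (x : ((cmDatum L 2 (Matrix.of fun i j : Fin 2 => if i.val + j.val + 1 = 2 then (1 : L) else 0)).Local v ×
      (cmDatum L 1 (Matrix.of fun i j : Fin 1 => if i.val + j.val + 1 = 1 then (1 : L) else 0)).Local v)),
      finExplicitDelta L v H' (x * a * x⁻¹) μ b = finExplicitDelta L v H' a μ b)
    (hr : ∀ (v : HeightOneSpectrum (𝓞 ↥(maximalRealSubfield L))) (a : ((cmDatum L 2 (Matrix.of fun i j : Fin 2 => if i.val + j.val + 1 = 2 then (1 : L) else 0)).Local v ×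
      (cmDatum L 1 (Matrix.of fun i j : Fin 1 => if i.val + j.val + 1 = 1 then (1 : L) else 0)).Local v)) (b y : (cmDatum L 3 H').Local v),
      finExplicitDelta L v H' a μ (y * b * y⁻¹) = finExplicitDelta L v H' a μ b)
    -- the socket's canonical families with the unit normalisations
    (νG : Measure ((cmDatum L 3 H').Local v)) [νG.IsHaarMeasure] [νG.IsMulRightInvariant]
    {mG : OrbitalMeasureFamily ((cmDatum L 3 H').Local v)}
    (hmG : mG.IsCanonical (fun γ => IsRegularElt (γ.val : GL (Fin 3) (UnitaryGroup.LocalRing L v))) νG)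
    (hνG : νG (cmLocalIntegralLevel L 3 H' v : Set ((cmDatum L 3 H').Local v)) = 1)
    (νH : Measure ((cmDatum L 2 (Matrix.of fun i j : Fin 2 => if i.val + j.val + 1 = 2 then (1 : L) else 0)).Local v ×
      (cmDatum L 1 (Matrix.of fun i j : Fin 1 => if i.val + j.val + 1 = 1 then (1 : L) else 0)).Local v)) [νH.IsHaarMeasure] [νH.IsMulRightInvariant]
    {mH : OrbitalMeasureFamily ((cmDatum L 2 (Matrix.of fun i j : Fin 2 => if i.val + j.val + 1 = 2 then (1 : L) else 0)).Local v ×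
      (cmDatum L 1 (Matrix.of fun i j : Fin 1 => if i.val + j.val + 1 = 1 then (1 : L) else 0)).Local v)}
    (hmH : mH.IsCanonical (IsLocalGRegular L v) νH)
    (hνH : νH ((((cmLocalIntegralLevel L 2 (Matrix.of fun i j : Fin 2 => if i.val + j.val + 1 = 2 then (1 : L) else 0) v).prod
      (cmLocalIntegralLevel L 1 (Matrix.of fun i j : Fin 1 => if i.val + j.val + 1 = 1 then (1 : L) else 0) v)) :
        Subgroup ((cmDatum L 2 (Matrix.of fun i j : Fin 2 => if i.val + j.val + 1 = 2 then (1 : L) else 0)).Local v ×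
          (cmDatum L 1 (Matrix.of fun i j : Fin 1 => if i.val + j.val + 1 = 1 then (1 : L) else 0)).Local v)) :
        Set ((cmDatum L 2 (Matrix.of fun i j : Fin 2 => if i.val + j.val + 1 = 2 then (1 : L) else 0)).Local v ×
          (cmDatum L 1 (Matrix.of fun i j : Fin 1 => if i.val + j.val + 1 = 1 then (1 : L) else 0)).Local v)) = 1)
    -- the LEVEL-MATCHING stub frame of `G′_v`
    (T₀ : GL (Fin 3) (UnitaryGroup.LocalRing L v)) {a₀ : UnitaryGroup.LocalRing L v} (ha₀ : IsUnit a₀)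
    (hT₀ : formCongr (conjLocal L (IsCMField.complexConj L) v) T₀ (H'.map (algebraMap L (UnitaryGroup.LocalRing L v))) =
      a₀ • (Matrix.of fun i j : Fin 3 => if i.val + j.val + 1 = 3 then (1 : L) else 0).map (algebraMap L (UnitaryGroup.LocalRing L v)))
    (hlev : ∀ g : (cmDatum L 3 H').Local v,
      (cmDatumLocalCongr L v T₀ ha₀ hT₀).symm g ∈ cmLocalIntegralLevel L 3 (Matrix.of fun i j : Fin 3 => if i.val + j.val + 1 = 3 then (1 : L) else 0) v ↔
        g ∈ cmLocalIntegralLevel L 3 H' v)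
    -- the two hyperspecial levels `U(Φ₃)(𝒪_v)`, `U(Φ₂)(𝒪_v)` in the `unitaryGroupOfForm` spelling of the ★ (B2a) binders (any names; pinned by `hK₃v`, `hK₂eq`)
    {K₃ : Subgroup ↥(unitaryGroupOfForm (conjLocal L (IsCMField.complexConj L) v) (cmLocalForm L 3 v))}
    (hK₃v : ∀ g, g ∈ K₃ ↔ g ∈ cmLocalIntegralLevel L 3 (Matrix.of fun i j : Fin 3 => if i.val + j.val + 1 = 3 then (1 : L) else 0) v)
    (K₂ : Subgroup ↥(unitaryGroupOfForm (conjLocal L (IsCMField.complexConj L) v) (cmLocalForm L 2 v)))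
    (hK₂eq : K₂ = cmLocalIntegralLevel L 2 (Matrix.of fun i j : Fin 2 => if i.val + j.val + 1 = 2 then (1 : L) else 0) v)
    -- the one-place models (binder pairs)
    (eA₃ : (cmDatum L 3 (Matrix.of fun i j : Fin 3 => if i.val + j.val + 1 = 3 then (1 : L) else 0)).Local v ≃ₜ*
      ↥(unitaryGroupOfForm (galAdicCompletionMap (L := L) (IsCMField.complexConj L) hw) ((StdForm.antidiagonal 3).over (w.1.adicCompletion L))))
    (heA₃ : ∀ g : (cmDatum L 3 (Matrix.of fun i j : Fin 3 => if i.val + j.val + 1 = 3 then (1 : L) else 0)).Local v,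
      ((eA₃ g : ↥(unitaryGroupOfForm (galAdicCompletionMap (L := L) (IsCMField.complexConj L) hw) ((StdForm.antidiagonal 3).over (w.1.adicCompletion L)))) :
          GL (Fin 3) (w.1.adicCompletion L)) =
        ((localNonsplitEquiv (IsCMField.complexConj L) (Matrix.of fun i j : Fin 3 => if i.val + j.val + 1 = 3 then (1 : L) else 0)
            (IsCMField.complexConj_ne_one L) w hw g :
          ↥(unitaryGroupOfForm (galAdicCompletionMap (L := L) (IsCMField.complexConj L) hw)
            (placeForm (Matrix.of fun i j : Fin 3 => if i.val + j.val + 1 = 3 then (1 : L) else 0) w.1))) : GL (Fin 3) (w.1.adicCompletion L)))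
    (eA₂ : (cmDatum L 2 (Matrix.of fun i j : Fin 2 => if i.val + j.val + 1 = 2 then (1 : L) else 0)).Local v ≃ₜ*
      ↥(unitaryGroupOfForm (galAdicCompletionMap (L := L) (IsCMField.complexConj L) hw) ((StdForm.antidiagonal 2).over (w.1.adicCompletion L))))
    (heA₂ : ∀ g : (cmDatum L 2 (Matrix.of fun i j : Fin 2 => if i.val + j.val + 1 = 2 then (1 : L) else 0)).Local v,
      ((eA₂ g : ↥(unitaryGroupOfForm (galAdicCompletionMap (L := L) (IsCMField.complexConj L) hw) ((StdForm.antidiagonal 2).over (w.1.adicCompletion L)))) :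
          GL (Fin 2) (w.1.adicCompletion L)) =
        ((localNonsplitEquiv (IsCMField.complexConj L) (Matrix.of fun i j : Fin 2 => if i.val + j.val + 1 = 2 then (1 : L) else 0)
            (IsCMField.complexConj_ne_one L) w hw g :
          ↥(unitaryGroupOfForm (galAdicCompletionMap (L := L) (IsCMField.complexConj L) hw)
            (placeForm (Matrix.of fun i j : Fin 2 => if i.val + j.val + 1 = 2 then (1 : L) else 0) w.1))) : GL (Fin 2) (w.1.adicCompletion L)))
    -- the Hecke data at `w` (the socket's carriers, an unramified datum, a Satake-graph pair)
    {ϖ : w.1.adicCompletion L} (hdw : UnramifiedLocalConjDatum (galAdicCompletionMap (L := L) (IsCMField.complexConj L) hw) ϖ)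
    (φ : heckeAlgebra ℂ ↥(unitaryGroupOfForm (galAdicCompletionMap (L := L) (IsCMField.complexConj L) hw) ((StdForm.antidiagonal 3).over (w.1.adicCompletion L)))
      (unitaryInt (galAdicCompletionMap (L := L) (IsCMField.complexConj L) hw) ((StdForm.antidiagonal 3).over (w.1.adicCompletion L))))
    (φH : heckeAlgebra ℂ ↥(unitaryGroupOfForm (galAdicCompletionMap (L := L) (IsCMField.complexConj L) hw) ((StdForm.antidiagonal 2).over (w.1.adicCompletion L)))
      (unitaryInt (galAdicCompletionMap (L := L) (IsCMField.complexConj L) hw) ((StdForm.antidiagonal 2).over (w.1.adicCompletion L))))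
    (hgraph : ∀ z : ℂˣ,
      unitaryHeckeEigencharacterAdic (IsCMField.complexConj L) (IsCMField.complexConj_ne_one L) v w hw hv ![z, 1] φH =
        unitaryHeckeEigencharacterAdic (IsCMField.complexConj L) (IsCMField.complexConj_ne_one L) v w hw hv ![-z, 1, 1] φ)
    -- `γ_H` on the Levi stratum, `G`-regular, `ord_w d′₀ = m`
    {γH : ((cmDatum L 2 (Matrix.of fun i j : Fin 2 => if i.val + j.val + 1 = 2 then (1 : L) else 0)).Local v ×
      (cmDatum L 1 (Matrix.of fun i j : Fin 1 => if i.val + j.val + 1 = 1 then (1 : L) else 0)).Local v)}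
    {d' : Fin 2 → (UnitaryGroup.LocalRing L v)ˣ} (hd' : glDiagonal 2 (UnitaryGroup.LocalRing L v) d' = (γH.1.val : GL (Fin 2) (UnitaryGroup.LocalRing L v)))
    (hreg : IsLocalGRegular L v γH)
    (ha : IsUnit ((((d' 0)⁻¹ * (isUnit_finGammaTwo L v γH).unit : (UnitaryGroup.LocalRing L v)ˣ) : UnitaryGroup.LocalRing L v) - 1))
    (hb : IsUnit ((((d' 0)⁻¹ * d' 1 : (UnitaryGroup.LocalRing L v)ˣ) : UnitaryGroup.LocalRing L v) - 1))
    (h12 : IsUnit (finGammaTwo L v γH - (d' 1 : UnitaryGroup.LocalRing L v)))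
    {m : ℤ} (hm : Valued.v ((d' 0 : UnitaryGroup.LocalRing L v) w) = WithZero.exp (-m)) :
    stableOrbitalIntegralRel (IsLocalStablyConjH L v) mH
        (fun h : ((cmDatum L 2 (Matrix.of fun i j : Fin 2 => if i.val + j.val + 1 = 2 then (1 : L) else 0)).Local v ×
            (cmDatum L 1 (Matrix.of fun i j : Fin 1 => if i.val + j.val + 1 = 1 then (1 : L) else 0)).Local v) =>
          (heckeAlgebra.toVector (unitaryInt (galAdicCompletionMap (L := L) (IsCMField.complexConj L) hw) ((StdForm.antidiagonal 2).over (w.1.adicCompletion L))) φH).coeff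
            ((eA₂ h.1 : ↥(unitaryGroupOfForm (galAdicCompletionMap (L := L) (IsCMField.complexConj L) hw) ((StdForm.antidiagonal 2).over (w.1.adicCompletion L)))) :
              ↥(unitaryGroupOfForm (galAdicCompletionMap (L := L) (IsCMField.complexConj L) hw) ((StdForm.antidiagonal 2).over (w.1.adicCompletion L))) ⧸
                unitaryInt (galAdicCompletionMap (L := L) (IsCMField.complexConj L) hw) ((StdForm.antidiagonal 2).over (w.1.adicCompletion L))))
        γH =
      ∑ᶠ c : ConjClasses ((cmDatum L 3 H').Local v), (finExplicitCollection L H' μ hl hr v).Δ γH (Quotient.out c) *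
        classOrbitalIntegral mG
          (fun g : (cmDatum L 3 H').Local v =>
            (heckeAlgebra.toVector (unitaryInt (galAdicCompletionMap (L := L) (IsCMField.complexConj L) hw) ((StdForm.antidiagonal 3).over (w.1.adicCompletion L))) φ).coeff
              ((((cmDatumLocalCongr L v T₀ ha₀ hT₀).symm.trans eA₃) g :
                  ↥(unitaryGroupOfForm (galAdicCompletionMap (L := L) (IsCMField.complexConj L) hw) ((StdForm.antidiagonal 3).over (w.1.adicCompletion L)))) :
                ↥(unitaryGroupOfForm (galAdicCompletionMap (L := L) (IsCMField.complexConj L) hw) ((StdForm.antidiagonal 3).over (w.1.adicCompletion L))) ⧸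
                  unitaryInt (galAdicCompletionMap (L := L) (IsCMField.complexConj L) hw) ((StdForm.antidiagonal 3).over (w.1.adicCompletion L)))) c := by
  haveI : Algebra.IsQuadraticExtension ↥(maximalRealSubfield L) L := IsCMField.isQuadraticExtension L
  haveI : Finite 𝓀[w.1.adicCompletion L] := finite_residueField_adicCompletion L w.1
  -- Borel structures on the auxiliary carriers (the socket fixes them only on `G′_v` and `H_v`)
  letI mΦ₃ : MeasurableSpace ↥(unitaryGroupOfForm (conjLocal L (IsCMField.complexConj L) v) (cmLocalForm L 3 v)) := borel _; haveI : BorelSpace ↥(unitaryGroupOfForm (conjLocal L (IsCMField.complexConj L) v) (cmLocalForm L 3 v)) := ⟨rfl⟩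
  letI mΦ₂ : MeasurableSpace ↥(unitaryGroupOfForm (conjLocal L (IsCMField.complexConj L) v) (cmLocalForm L 2 v)) := borel _; haveI : BorelSpace ↥(unitaryGroupOfForm (conjLocal L (IsCMField.complexConj L) v) (cmLocalForm L 2 v)) := ⟨rfl⟩
  letI mU₃ : MeasurableSpace ↥(unitaryGroupOfForm (galAdicCompletionMap (L := L) (IsCMField.complexConj L) hw) ((StdForm.antidiagonal 3).over (w.1.adicCompletion L))) := borel _
  haveI : BorelSpace ↥(unitaryGroupOfForm (galAdicCompletionMap (L := L) (IsCMField.complexConj L) hw) ((StdForm.antidiagonal 3).over (w.1.adicCompletion L))) := ⟨rfl⟩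
  letI mU₂ : MeasurableSpace ↥(unitaryGroupOfForm (galAdicCompletionMap (L := L) (IsCMField.complexConj L) hw) ((StdForm.antidiagonal 2).over (w.1.adicCompletion L))) := borel _
  haveI : BorelSpace ↥(unitaryGroupOfForm (galAdicCompletionMap (L := L) (IsCMField.complexConj L) hw) ((StdForm.antidiagonal 2).over (w.1.adicCompletion L))) := ⟨rfl⟩
  -- topological structure of the two quasi-split groups
  haveI : LocallyCompactSpace ↥(unitaryGroupOfForm (conjLocal L (IsCMField.complexConj L) v) (cmLocalForm L 3 v)) := locallyCompactSpace_local (IsCMField.complexConj L) 3 _ v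
  haveI : SecondCountableTopology ↥(unitaryGroupOfForm (conjLocal L (IsCMField.complexConj L) v) (cmLocalForm L 3 v)) := secondCountableTopology_local (IsCMField.complexConj L) 3 _ v
  haveI : LocallyCompactSpace ↥(unitaryGroupOfForm (conjLocal L (IsCMField.complexConj L) v) (cmLocalForm L 2 v)) := locallyCompactSpace_local (IsCMField.complexConj L) 2 _ v
  haveI : SecondCountableTopology ↥(unitaryGroupOfForm (conjLocal L (IsCMField.complexConj L) v) (cmLocalForm L 2 v)) := secondCountableTopology_local (IsCMField.complexConj L) 2 _ v
  -- the hyperspecial levels `K₃ = U(Φ₃)(𝒪_v)`, `K₂ = U(Φ₂)(𝒪_v)` (compact open; the `unitaryGroupOfForm` spelling of the ★ (B2a) binders) and the radicals `N₃`, `N₂` (closed)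
  have hK₃eq : K₃ = cmLocalIntegralLevel L 3 (Matrix.of fun i j : Fin 3 => if i.val + j.val + 1 = 3 then (1 : L) else 0) v := Subgroup.ext hK₃v
  have hK₃co : IsCompact (K₃ : Set ↥(unitaryGroupOfForm (conjLocal L (IsCMField.complexConj L) v) (cmLocalForm L 3 v))) ∧
      IsOpen (K₃ : Set ↥(unitaryGroupOfForm (conjLocal L (IsCMField.complexConj L) v) (cmLocalForm L 3 v))) := by
    rw [hK₃eq]; exact isCompact_isOpen_cmLocalIntegralLevel L 3 (Matrix.of fun i j : Fin 3 => if i.val + j.val + 1 = 3 then (1 : L) else 0) v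
  have hK₂co : IsCompact (K₂ : Set ↥(unitaryGroupOfForm (conjLocal L (IsCMField.complexConj L) v) (cmLocalForm L 2 v))) ∧
      IsOpen (K₂ : Set ↥(unitaryGroupOfForm (conjLocal L (IsCMField.complexConj L) v) (cmLocalForm L 2 v))) := by
    rw [hK₂eq]; exact isCompact_isOpen_cmLocalIntegralLevel L 2 (Matrix.of fun i j : Fin 2 => if i.val + j.val + 1 = 2 then (1 : L) else 0) v
  have hN₃c : IsClosed (((cmBorelTriple L 3 v).N : Subgroup ↥(unitaryGroupOfForm (conjLocal L (IsCMField.complexConj L) v) (cmLocalForm L 3 v))) : Set ↥(unitaryGroupOfForm (conjLocal L (IsCMField.complexConj L) v) (cmLocalForm L 3 v))) :=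
    isClosed_cmBorelTriple_N L v
  have hN₂c : IsClosed (((cmBorelTriple L 2 v).N : Subgroup ↥(unitaryGroupOfForm (conjLocal L (IsCMField.complexConj L) v) (cmLocalForm L 2 v))) : Set ↥(unitaryGroupOfForm (conjLocal L (IsCMField.complexConj L) v) (cmLocalForm L 2 v))) :=
    LineRing.isClosed_unipotentU _ _
  -- the auxiliary Iwasawa measures: Haar on the compact levels and on the radicals
  haveI : CompactSpace ↥K₃ := isCompact_iff_compactSpace.1 hK₃co.1
  haveI : LocallyCompactSpace ↥K₃ := hK₃co.1.isClosed.isClosedEmbedding_subtypeVal.locallyCompactSpace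
  haveI : CompactSpace ↥K₂ := isCompact_iff_compactSpace.1 hK₂co.1
  haveI : LocallyCompactSpace ↥K₂ := hK₂co.1.isClosed.isClosedEmbedding_subtypeVal.locallyCompactSpace
  haveI : LocallyCompactSpace ↥(cmBorelTriple L 3 v).N := hN₃c.isClosedEmbedding_subtypeVal.locallyCompactSpace
  haveI : SecondCountableTopology ↥(cmBorelTriple L 3 v).N := TopologicalSpace.Subtype.secondCountableTopology _
  haveI : LocallyCompactSpace ↥(cmBorelTriple L 2 v).N := hN₂c.isClosedEmbedding_subtypeVal.locallyCompactSpace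
  haveI : SecondCountableTopology ↥(cmBorelTriple L 2 v).N := TopologicalSpace.Subtype.secondCountableTopology _
  haveI : SigmaCompactSpace ↥(cmBorelTriple L 3 v).N := sigmaCompactSpace_of_locallyCompact_secondCountable
  haveI : SigmaCompactSpace ↥(cmBorelTriple L 2 v).N := sigmaCompactSpace_of_locallyCompact_secondCountable
  -- (`have` + `obtain` from the local: a direct `obtain … := ⟨…⟩` generalizes the term over the large goal and exhausts the heartbeat budget)
  have hκ₃ex : ∃ κ : Measure ↥K₃, κ.IsHaarMeasure ∧ IsFiniteMeasure κ := ⟨Measure.haar, inferInstance, CompactSpace.isFiniteMeasure⟩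
  have hκ₂ex : ∃ κ : Measure ↥K₂, κ.IsHaarMeasure ∧ IsFiniteMeasure κ := ⟨Measure.haar, inferInstance, CompactSpace.isFiniteMeasure⟩
  have hμN₃ex : ∃ μ : Measure ↥(cmBorelTriple L 3 v).N, μ.IsHaarMeasure ∧ SigmaFinite μ := ⟨Measure.haar, inferInstance, inferInstance⟩
  have hμN₂ex : ∃ μ : Measure ↥(cmBorelTriple L 2 v).N, μ.IsHaarMeasure ∧ SigmaFinite μ := ⟨Measure.haar, inferInstance, inferInstance⟩
  obtain ⟨κ₃, hκ₃i, hκ₃f⟩ := hκ₃ex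
  obtain ⟨κ₂, hκ₂i, hκ₂f⟩ := hκ₂ex
  obtain ⟨μN₃, hμN₃i, hμN₃s⟩ := hμN₃ex
  obtain ⟨μN₂, hμN₂i, hμN₂s⟩ := hμN₂ex
  haveI := hκ₃i; haveI := hκ₃f; haveI := hκ₂i; haveI := hκ₂f; haveI := hμN₃i; haveI := hμN₃s; haveI := hμN₂i; haveI := hμN₂s
  have hκ₃ : κ₃ Set.univ ≠ ∞ := measure_ne_top _ _
  have hκ₂ : κ₂ Set.univ ≠ ∞ := measure_ne_top _ _
  have hμN₃ : μN₃ {n : ↥(cmBorelTriple L 3 v).N | (n : ↥(unitaryGroupOfForm (conjLocal L (IsCMField.complexConj L) v) (cmLocalForm L 3 v))) ∈ K₃} ≠ ∞ :=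
    ((hN₃c.isClosedEmbedding_subtypeVal.isCompact_preimage hK₃co.1).measure_lt_top (μ := μN₃)).ne
  have hμN₂ : μN₂ {n : ↥(cmBorelTriple L 2 v).N | (n : ↥(unitaryGroupOfForm (conjLocal L (IsCMField.complexConj L) v) (cmLocalForm L 2 v))) ∈ K₂} ≠ ∞ :=
    ((hN₂c.isClosedEmbedding_subtypeVal.isCompact_preimage hK₂co.1).measure_lt_top (μ := μN₂)).ne
  -- the N-laws and K-laws of the one-place models (§1)
  have hN₃law := fun g => apply_mem_unipotentU_iff_of_coe_eq L w hw (N := 3) eA₃ heA₃ g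
  have hN₂law := fun g => apply_mem_unipotentU_iff_of_coe_eq L w hw (N := 2) eA₂ heA₂ g
  have hK₃law := fun g => apply_mem_unitaryInt_iff_of_coe_eq L w hw (Matrix.of fun i j : Fin 3 => if i.val + j.val + 1 = 3 then (1 : L) else 0) eA₃ heA₃ g
  have hK₂law := fun g => apply_mem_unitaryInt_iff_of_coe_eq L w hw (Matrix.of fun i j : Fin 2 => if i.val + j.val + 1 = 2 then (1 : L) else 0) eA₂ heA₂ g
  -- the restrictions of the one-place models to the radicals
  have hEN₃ex := exists_continuousMulEquiv_subgroup_of_forall_mem_iff eA₃ ((cmBorelTriple L 3 v).N)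
    (unipotentU (galAdicCompletionMap (L := L) (IsCMField.complexConj L) hw) ((StdForm.antidiagonal 3).over (w.1.adicCompletion L))) fun g => (hN₃law g).symm
  have hEN₂ex := exists_continuousMulEquiv_subgroup_of_forall_mem_iff eA₂ ((cmBorelTriple L 2 v).N)
    (unipotentU (galAdicCompletionMap (L := L) (IsCMField.complexConj L) hw) ((StdForm.antidiagonal 2).over (w.1.adicCompletion L))) fun g => (hN₂law g).symm
  obtain ⟨EN₃, hEN₃⟩ := hEN₃ex
  obtain ⟨EN₂, hEN₂⟩ := hEN₂ex
  -- the composite `eG ∘ e = eA₃`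
  have hcomp : ∀ g : ↥(unitaryGroupOfForm (conjLocal L (IsCMField.complexConj L) v) (cmLocalForm L 3 v)),
      ((cmDatumLocalCongr L v T₀ ha₀ hT₀).symm.trans eA₃) (cmDatumLocalCongr L v T₀ ha₀ hT₀ g) = eA₃ g := fun g => by
    show eA₃ ((cmDatumLocalCongr L v T₀ ha₀ hT₀).symm (cmDatumLocalCongr L v T₀ ha₀ hT₀ g)) = eA₃ g
    rw [ContinuousMulEquiv.symm_apply_apply]
  -- the Levi datum of `γ_H` in `U(Φ₃)`-coordinates and the torus entry laws
  have hι := endoEmbLocal_eq_glDiagonal_of_fst_eq L v γH hd'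
  have hEt := coe_apply_eq_diagonal_of_coe_eq L w hw (Matrix.of fun i j : Fin 3 => if i.val + j.val + 1 = 3 then (1 : L) else 0) eA₃ heA₃ hι
  have hEHt := coe_apply_eq_diagonal_of_coe_eq L w hw (Matrix.of fun i j : Fin 2 => if i.val + j.val + 1 = 2 then (1 : L) else 0) eA₂ heA₂
    (g := γH.1) (d := d') hd'.symm
  have hd3 : (fun i : Fin 3 => ((![d' 0, (isUnit_finGammaTwo L v γH).unit, d' 1] i : (UnitaryGroup.LocalRing L v)ˣ) : UnitaryGroup.LocalRing L v) w) =
      ![(d' 0 : UnitaryGroup.LocalRing L v) w, finGammaTwo L v γH w, (d' 1 : UnitaryGroup.LocalRing L v) w] := by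
    funext i; fin_cases i
    · rfl
    · exact congrArg (fun x : UnitaryGroup.LocalRing L v => x w) (isUnit_finGammaTwo L v γH).unit_spec
    · rfl
  have hd2 : (fun i : Fin 2 => ((d' i : (UnitaryGroup.LocalRing L v)ˣ) : UnitaryGroup.LocalRing L v) w) =
      ![(d' 0 : UnitaryGroup.LocalRing L v) w, (d' 1 : UnitaryGroup.LocalRing L v) w] := by
    funext i; fin_cases i <;> simp
  rw [hd3] at hEt; rw [hd2] at hEHt
  -- `νG(e K₃) = νG(K′) = 1` by level matching
  have hνG1 : νG ((cmDatumLocalCongr L v T₀ ha₀ hT₀).symm ⁻¹' (K₃ : Set ↥(unitaryGroupOfForm (conjLocal L (IsCMField.complexConj L) v) (cmLocalForm L 3 v)))) = 1 := by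
    have hset : (cmDatumLocalCongr L v T₀ ha₀ hT₀).symm ⁻¹' (K₃ : Set ↥(unitaryGroupOfForm (conjLocal L (IsCMField.complexConj L) v) (cmLocalForm L 3 v))) =
        (cmLocalIntegralLevel L 3 H' v : Set ((cmDatum L 3 H').Local v)) :=
      -- (explicit `mem_preimage` ∕ `mem_coe` steps, so that the kernel is never asked to compare the carriers `U(Φ₃)_v` and `U(H′)_v`)
      Set.ext fun g => Set.mem_preimage.trans <| (SetLike.mem_coe (p := K₃)).trans <| (hK₃v _).trans <| (hlev g).trans SetLike.mem_coe.symm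
    rw [hset, hνG]
  -- assemble: ★ (B2d) CLOSED at these frames
  refine stableOrbitalIntegralRel_coeff_toVector_eq_finsum_finExplicitDelta_of_levi_of_frames L H' hH' hH'd w hw hv hH'w hH'i μ hμ hμω hl hr
    νG hmG νH hmH T₀ ha₀ hT₀ (K := K₃) hK₃v hK₃co.2 κ₃ hκ₃ μN₃ hμN₃ hdw
    ((cmDatumLocalCongr L v T₀ ha₀ hT₀).symm.trans eA₃)
    (fun g => by rw [hcomp]; exact hN₃law g) (fun g => by rw [hcomp]; exact (hK₃law g).trans (hK₃v g).symm) EN₃ (fun n => by rw [hcomp]; exact hEN₃ n) φ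
    K₂ hK₂eq hK₂co.2 κ₂ hκ₂ μN₂ hμN₂
    eA₂ hN₂law (fun g => (hK₂law g).trans (SetLike.ext_iff.1 hK₂eq g).symm) EN₂ hEN₂ φH hgraph hd' hreg ha hb h12 hm hνG1 hνH ?_ hEHt
  rw [hcomp]; exact hEt

end AtPlace

end Summit.HodgeConjecture.HodgeConjecture.R90.S6

end
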